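import Literature.NumberTheory.Sieve.QuadraticRootsPrimeModuliDFIBilinearCRT
import HarnessLib

/-!
# Duke–Friedlander–Iwaniec 1995, §5: fibre sums of the Weyl sums `ρ_h(mn)` (integer level)

Topic `Literature/NumberTheory/Sieve`.  Fifth file of the deduction of DFI's Propositions 1–2 from
Proposition 4 (W. Duke, J. B. Friedlander, H. Iwaniec, Ann. of Math. 141 (1995), §5
pp. 432–433).  The bilinear form `B(M, N)` is a sum over natural numbers `m, n`, so the Chinese
remainder identities of `QuadraticRootsPrimeModuliDFIBilinearCRT.lean` (stated in `ZMod`) are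
transported here to the integer-indexed objects that the Cauchy–Schwarz argument manipulates.
PROVED, for an arbitrary `f ∈ ℤ[X]` and integer `h`:

* `DFI1995.rootSet f d = {0 ≤ ν < d : d ∣ f(ν)}`, `DFI1995.eNat d h ν = e(hν/d)`, so that
  `ρ_h(d) = polyRootWeylSum f d h = ∑_{ν ∈ rootSet} e(hν/d)`;
* `DFI1995.fibreSum f h m n δ = ∑_{ν ∈ rootSet(mn), ν ≡ δ (m)} e(hν/mn)` and the arrangement
  `ρ_h(mn) = ∑_{δ ∈ rootSet(m)} fibreSum(δ)` (`polyRootWeylSum_mul_eq_sum_fibreSum`) — "First we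
  arrange as follows …" (p. 432);
* `DFI1995.fibrePairSum f h m n₁ n₂ = ∑_{δ} fibreSum_{n₁}(δ) conj(fibreSum_{n₂}(δ))`, the sums
  `ΣΣ_{f(ν_j) ≡ 0 (mn_j), ν₁ ≡ ν₂ (m)} e(ν₁h/mn₁ − ν₂h/mn₂)` of `B_{n₁n₂}(M)` (p. 433), with
  **the diagonal bound** `|fibrePairSum(m; n, n)| ≤ ρ(m) ρ(n)²` for `(m, n) = 1`
  (`norm_fibrePairSum_diag_le`, fibres have `≤ ρ(n)` elements by CRT) and **the off-diagonal
  identity** `fibrePairSum(m; n₁, n₂) = ρ_{h(n₂−n₁)}(m n₁ n₂)` for `m ⊥ n₂`, `n₁ ⊥ n₂`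
  (`fibrePairSum_eq_polyRootWeylSum`, from `DFI1995.crt_fibre_sum_eq`).

## References

* W. Duke, J. B. Friedlander, H. Iwaniec, Ann. of Math. (2) 141 (1995), 423–441, §5 pp. 432–433.
  [cite: DukeFriedlanderIwaniec1995, §5 pp. 432–433]
-/

noncomputable section

namespace Literature.NumberTheory.Sieve

open scoped BigOperators Polynomial ComplexConjugate
open Finset Polynomial

namespace DFI1995

variable (f : ℤ[X])

/-! ### The integer-indexed objects -/

/-- `e(hν/d) = exp(2πi hν/d)` (the summand of `polyRootWeylSum`). [folklore] -/
def eNat (d : ℕ) (h : ℤ) (ν : ℕ) : ℂ := Complex.exp (2 * Real.pi * Complex.I * (h * ν / d : ℂ))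

/-- The root set `{0 ≤ ν < d : d ∣ f(ν)}` (the index set of `polyRootWeylSum f d h`). [folklore] -/
def rootSet (d : ℕ) : Finset ℕ := (Finset.range d).filter (fun ν : ℕ => (d : ℤ) ∣ f.eval (ν : ℤ))

variable {f}

/-- Membership in `rootSet`. [folklore] -/
theorem mem_rootSet {d ν : ℕ} : ν ∈ rootSet f d ↔ ν < d ∧ (d : ℤ) ∣ f.eval (ν : ℤ) := by
  rw [rootSet, Finset.mem_filter, Finset.mem_range]

variable (f)

/-- `polyRootWeylSum f d h = ∑_{ν ∈ rootSet} e(hν/d)`. [folklore] -/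
theorem polyRootWeylSum_eq_sum_rootSet (d : ℕ) (h : ℤ) :
    polyRootWeylSum f d h = ∑ ν ∈ rootSet f d, eNat d h ν := rfl

/-- `#rootSet f d = ρ_f(d)`. [folklore] -/
theorem card_rootSet (d : ℕ) : (rootSet f d).card = polyRootCountMod ![f] d :=
  card_filter_dvd_eval_eq_polyRootCountMod f d

/-- `|e(hν/d)| = 1`. [folklore] -/
theorem norm_eNat (d : ℕ) (h : ℤ) (ν : ℕ) : ‖eNat d h ν‖ = 1 := by
  rw [eNat, Complex.norm_exp]
  rw [show (2 * ↑Real.pi * Complex.I * (↑h * ↑ν / ↑d : ℂ)) =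
      ((2 * Real.pi * (h * ν / d) : ℝ) : ℂ) * Complex.I by push_cast; ring]
  simp [Complex.mul_re]

/-- Reduction of roots: if `m ∣ d` and `d ∣ f(ν)` then `ν mod m ∈ rootSet f m`. [folklore] -/
theorem mod_mem_rootSet {m d ν : ℕ} (hm : 0 < m) (hmd : m ∣ d) (hν : (d : ℤ) ∣ f.eval (ν : ℤ)) :
    ν % m ∈ rootSet f m := by
  rw [mem_rootSet]
  refine ⟨Nat.mod_lt _ hm, ?_⟩
  have h1 : (m : ℤ) ∣ f.eval (ν : ℤ) := (Int.natCast_dvd_natCast.2 hmd).trans hν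
  have h2 : (m : ℤ) ∣ f.eval (ν : ℤ) - f.eval ((ν % m : ℕ) : ℤ) := by
    refine dvd_trans ?_ (sub_dvd_eval_sub (ν : ℤ) ((ν % m : ℕ) : ℤ) f)
    refine ⟨(ν / m : ℕ), ?_⟩
    have := Nat.div_add_mod ν m
    push_cast [Nat.cast_sub (Nat.mod_le ν m)] at *
    linarith [this]
  have := dvd_sub h1 h2
  simpa using this

/-- **The fibre sums** `fibreSum f h m n δ = ∑_{ν ∈ rootSet(mn), ν ≡ δ (mod m)} e(hν/mn)`
(`0 ≤ δ < m` a root of `f` modulo `m`). [cite: DukeFriedlanderIwaniec1995, §5 p. 432] -/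
def fibreSum (h : ℤ) (m n δ : ℕ) : ℂ :=
  ∑ ν ∈ (rootSet f (m * n)).filter (fun ν : ℕ => ν % m = δ), eNat (m * n) h ν

/-- **The arrangement `ρ_h(mn) = ∑_{f(δ) ≡ 0 (m)} ∑_{f(ν) ≡ 0 (mn), ν ≡ δ (m)} e(νh/mn)`** (p. 432).
[cite: DukeFriedlanderIwaniec1995, §5 p. 432] -/
theorem polyRootWeylSum_mul_eq_sum_fibreSum (h : ℤ) {m : ℕ} (hm : 0 < m) (n : ℕ) :
    polyRootWeylSum f (m * n) h = ∑ δ ∈ rootSet f m, fibreSum f h m n δ := by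
  rw [polyRootWeylSum_eq_sum_rootSet]
  unfold fibreSum
  exact (Finset.sum_fiberwise_of_maps_to (g := fun ν : ℕ => ν % m)
    (fun ν hν => mod_mem_rootSet f hm (dvd_mul_right m n) (mem_rootSet.1 hν).2) _).symm

/-- `|fibreSum| ≤ #(fibre)`. [folklore] -/
theorem norm_fibreSum_le_card (h : ℤ) (m n δ : ℕ) :
    ‖fibreSum f h m n δ‖ ≤ #((rootSet f (m * n)).filter (fun ν : ℕ => ν % m = δ)) := by
  unfold fibreSum
  refine (norm_sum_le _ _).trans ?_
  refine (Finset.sum_le_card_nsmul _ _ 1 fun ν _ => (norm_eNat _ _ _).le).trans ?_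
  simp

/-- **Fibres are small** (integer form): for `(m, n) = 1`, `#{ν ∈ rootSet(mn) : ν ≡ δ (m)} ≤ ρ_f(n)`
(`ν ↦ ν mod n` is injective on the fibre by the Chinese remainder theorem). [folklore] -/
theorem card_fibre_nat_le {m n : ℕ} (hn : 0 < n) (hmn : m.Coprime n) (δ : ℕ) :
    #((rootSet f (m * n)).filter (fun ν : ℕ => ν % m = δ)) ≤ polyRootCountMod ![f] n := by
  rw [← card_rootSet]
  refine Finset.card_le_card_of_injOn (fun ν => ν % n) ?_ ?_
  · intro ν hν
    rw [Finset.mem_coe, Finset.mem_filter] at hν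
    exact mod_mem_rootSet f hn (dvd_mul_left n m) (mem_rootSet.1 hν.1).2
  · intro ν hν ν' hν' heq
    rw [Finset.mem_coe, Finset.mem_filter, mem_rootSet] at hν hν'
    have h1 : ν ≡ ν' [MOD m] := by
      change ν % m = ν' % m
      rw [hν.2, hν'.2]
    have h2 : ν ≡ ν' [MOD n] := heq
    have h3 : ν ≡ ν' [MOD m * n] := (Nat.modEq_and_modEq_iff_modEq_mul hmn).1 ⟨h1, h2⟩
    exact Nat.ModEq.eq_of_lt_of_lt h3 hν.1.1 hν'.1.1

/-- **The pair sums** `fibrePairSum f h m n₁ n₂ = ∑_{δ ∈ rootSet(m)} fibreSum_{n₁}(δ) conj(fibreSum_{n₂}(δ))`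
`= ΣΣ_{f(ν_j) ≡ 0 (mn_j), ν₁ ≡ ν₂ (m)} e(ν₁h/mn₁ − ν₂h/mn₂)` (the inner sums of `B_{n₁n₂}(M)`,
p. 433). [cite: DukeFriedlanderIwaniec1995, §5 p. 433] -/
def fibrePairSum (h : ℤ) (m n₁ n₂ : ℕ) : ℂ :=
  ∑ δ ∈ rootSet f m, fibreSum f h m n₁ δ * conj (fibreSum f h m n₂ δ)

/-- **The diagonal** ("For `n₁ = n₂` we shall use the trivial bound", p. 433): for `(m, n) = 1`,
`|fibrePairSum(m; n, n)| ≤ ρ_f(m) ρ_f(n)²`. [cite: DukeFriedlanderIwaniec1995, §5 p. 433] -/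
theorem norm_fibrePairSum_diag_le (h : ℤ) {m n : ℕ} (hm : 0 < m) (hn : 0 < n) (hmn : m.Coprime n) :
    ‖fibrePairSum f h m n n‖ ≤ (polyRootCountMod ![f] m : ℝ) * (polyRootCountMod ![f] n : ℝ) ^ 2 := by
  unfold fibrePairSum
  refine (norm_sum_le _ _).trans ?_
  have hterm : ∀ δ ∈ rootSet f m, ‖fibreSum f h m n δ * conj (fibreSum f h m n δ)‖ ≤
      (polyRootCountMod ![f] n : ℝ) * #((rootSet f (m * n)).filter (fun ν : ℕ => ν % m = δ)) := by
    intro δ _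
    rw [norm_mul, Complex.norm_conj]
    exact mul_le_mul ((norm_fibreSum_le_card f h m n δ).trans (by exact_mod_cast card_fibre_nat_le f hn hmn δ))
      (norm_fibreSum_le_card f h m n δ) (norm_nonneg _) (Nat.cast_nonneg _)
  refine (Finset.sum_le_sum hterm).trans ?_
  rw [← Finset.mul_sum]
  have hcard : ∑ δ ∈ rootSet f m, (#((rootSet f (m * n)).filter (fun ν : ℕ => ν % m = δ)) : ℝ) =
      polyRootCountMod ![f] (m * n) := by
    rw [← card_rootSet]
    have := Finset.card_eq_sum_card_fiberwise (s := rootSet f (m * n)) (t := rootSet f m)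
      (f := fun ν : ℕ => ν % m)
      (fun ν hν => mod_mem_rootSet f hm (dvd_mul_right m n) (mem_rootSet.1 hν).2)
    rw [this]
    push_cast
    rfl
  rw [hcard, polyRootCountMod_mul_of_coprime f hmn]
  push_cast
  nlinarith [Nat.cast_nonneg (α := ℝ) (polyRootCountMod ![f] m),
    Nat.cast_nonneg (α := ℝ) (polyRootCountMod ![f] n)]

/-! ### Translation to `ZMod` -/

/-- `conj ψ_N(x) = ψ_N(−x)`. [folklore] -/
theorem conj_stdAddChar {N : ℕ} [NeZero N] (x : ZMod N) :
    conj (ZMod.stdAddChar x) = ZMod.stdAddChar (-x) := by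
  obtain ⟨v, rfl⟩ : ∃ v : ℤ, (v : ZMod N) = x := ⟨(x.val : ℤ), by simp⟩
  rw [← Int.cast_neg, ZMod.stdAddChar_coe, ZMod.stdAddChar_coe, ← Complex.exp_conj]
  congr 1
  simp only [map_div₀, map_mul, map_ofNat, Complex.conj_ofReal, Complex.conj_I, map_intCast,
    map_natCast, Int.cast_neg]
  ring

/-- Sums over `rootSet f m` are sums over `polyRootsMod f m ⊆ ZMod m`. [folklore] -/
theorem sum_rootSet_eq_sum_polyRootsMod {m : ℕ} [NeZero m] (F : ZMod m → ℂ) :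
    ∑ δ ∈ rootSet f m, F (δ : ZMod m) = ∑ x ∈ polyRootsMod f m, F x := by
  refine Finset.sum_nbij' (fun n : ℕ ↦ (n : ZMod m)) (fun x : ZMod m ↦ x.val) ?_ ?_ ?_ ?_ ?_
  · intro n hn
    rw [natCast_mem_polyRootsMod]
    exact (mem_rootSet.1 hn).2
  · intro x hx
    rw [mem_rootSet]
    refine ⟨ZMod.val_lt x, ?_⟩
    rw [← natCast_mem_polyRootsMod (f := f), ZMod.natCast_zmod_val]
    exact hx
  · intro n hn
    exact ZMod.val_natCast_of_lt (mem_rootSet.1 hn).1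
  · intro x _
    exact ZMod.natCast_zmod_val x
  · intro n _
    rfl

/-- **The fibre sums in `ZMod` form**: for `δ < m`,
`fibreSum f h m n δ = ∑_{ν ∈ R(mn), ν ↦ δ ∈ ℤ/m} ψ_{mn}(h ν)`. [folklore] -/
theorem fibreSum_eq_zmod (h : ℤ) {m n δ : ℕ} [NeZero m] [NeZero (m * n)] (hδ : δ < m) :
    fibreSum f h m n δ = ∑ ν ∈ (polyRootsMod f (m * n)).filter
      (fun ν => ZMod.castHom (dvd_mul_right m n) (ZMod m) ν = (δ : ZMod m)),
        ZMod.stdAddChar ((h : ZMod (m * n)) * ν) := by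
  unfold fibreSum
  refine Finset.sum_nbij' (fun ν : ℕ ↦ (ν : ZMod (m * n))) (fun x : ZMod (m * n) ↦ x.val) ?_ ?_ ?_ ?_ ?_
  · intro ν hν
    rw [Finset.mem_filter, mem_rootSet] at hν
    rw [Finset.mem_filter, natCast_mem_polyRootsMod, map_natCast, ZMod.natCast_eq_natCast_iff',
      Nat.mod_eq_of_lt hδ]
    exact ⟨hν.1.2, hν.2⟩
  · intro x hx
    rw [Finset.mem_filter] at hx
    rw [Finset.mem_filter, mem_rootSet]
    refine ⟨⟨ZMod.val_lt x, ?_⟩, ?_⟩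
    · rw [← natCast_mem_polyRootsMod (f := f), ZMod.natCast_zmod_val]
      exact hx.1
    · have := hx.2
      rw [← ZMod.natCast_zmod_val x, map_natCast, ZMod.natCast_eq_natCast_iff', Nat.mod_eq_of_lt hδ] at this
      exact this
  · intro ν hν
    rw [Finset.mem_filter, mem_rootSet] at hν
    exact ZMod.val_natCast_of_lt hν.1.1
  · intro x _
    exact ZMod.natCast_zmod_val x
  · intro ν _
    have : ((h : ZMod (m * n)) * (ν : ZMod (m * n))) = ((h * ν : ℤ) : ZMod (m * n)) := by push_cast; ring
    rw [this, ZMod.stdAddChar_coe, eNat]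
    congr 1
    push_cast
    ring

/-- The conjugate fibre sums in `ZMod` form: `conj fibreSum = ∑ ψ_{mn}(−h ν)`. [folklore] -/
theorem conj_fibreSum_eq_zmod (h : ℤ) {m n δ : ℕ} [NeZero m] [NeZero (m * n)] (hδ : δ < m) :
    conj (fibreSum f h m n δ) = ∑ ν ∈ (polyRootsMod f (m * n)).filter
      (fun ν => ZMod.castHom (dvd_mul_right m n) (ZMod m) ν = (δ : ZMod m)),
        ZMod.stdAddChar ((-h : ZMod (m * n)) * ν) := by
  rw [fibreSum_eq_zmod f h hδ, map_sum]
  refine Finset.sum_congr rfl fun ν _ => ?_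
  rw [conj_stdAddChar, neg_mul]

/-- Regrouping products of fibre sums: `∑_δ (∑_{c₁ x = δ} a_x)(∑_{c₂ y = δ} b_y) = ∑_x ∑_{c₂ y = c₁ x} a_x b_y`
when `c₁` maps into the index set of `δ`. [folklore] -/
theorem sum_fibre_mul_fibre {ι₁ ι₂ κ : Type*} [DecidableEq κ] (R : Finset κ) (R₁ : Finset ι₁)
    (R₂ : Finset ι₂) (c₁ : ι₁ → κ) (c₂ : ι₂ → κ) (h₁ : ∀ x ∈ R₁, c₁ x ∈ R) (a : ι₁ → ℂ) (b : ι₂ → ℂ) :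
    ∑ δ ∈ R, (∑ x ∈ R₁.filter (fun x => c₁ x = δ), a x) * (∑ y ∈ R₂.filter (fun y => c₂ y = δ), b y) =
      ∑ x ∈ R₁, ∑ y ∈ R₂.filter (fun y => c₂ y = c₁ x), a x * b y := by
  rw [← Finset.sum_fiberwise_of_maps_to h₁]
  refine Finset.sum_congr rfl fun δ _ => ?_
  rw [Finset.sum_mul_sum]
  refine Finset.sum_congr rfl fun x hx => ?_
  rw [Finset.mem_filter] at hx
  rw [hx.2]

/-- **The off-diagonal identity** (integer form; "`m, n₁, n₂` are pairwise co-prime so we can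
write" `ΣΣ_{ν₁ ≡ ν₂ (m)} e(ν₁h/mn₁ − ν₂h/mn₂) = ∑_{f(ν) ≡ 0 (mn₁n₂)} e(ν(n₂ − n₁)h/mn₁n₂)`, p. 433):
for `m ⊥ n₂`, `n₁ ⊥ n₂` (all `≥ 1`), `fibrePairSum f h m n₁ n₂ = ρ_{h(n₂ − n₁)}(m n₁ n₂)`.
[cite: DukeFriedlanderIwaniec1995, §5 p. 433] -/
theorem fibrePairSum_eq_polyRootWeylSum (h : ℤ) {m n₁ n₂ : ℕ} (hm : 0 < m) (hn₁ : 0 < n₁)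
    (hn₂ : 0 < n₂) (hm2 : m.Coprime n₂) (h12 : n₁.Coprime n₂) :
    fibrePairSum f h m n₁ n₂ = polyRootWeylSum f (m * n₁ * n₂) (h * ((n₂ : ℤ) - (n₁ : ℤ))) := by
  haveI : NeZero m := ⟨hm.ne'⟩
  haveI : NeZero n₁ := ⟨hn₁.ne'⟩
  haveI : NeZero n₂ := ⟨hn₂.ne'⟩
  haveI : NeZero (m * n₁) := ⟨(Nat.mul_pos hm hn₁).ne'⟩
  haveI : NeZero (m * n₂) := ⟨(Nat.mul_pos hm hn₂).ne'⟩
  haveI : NeZero (m * n₁ * n₂) := ⟨(Nat.mul_pos (Nat.mul_pos hm hn₁) hn₂).ne'⟩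
  unfold fibrePairSum
  -- each term in `ZMod` form
  have hterm : ∀ δ ∈ rootSet f m, fibreSum f h m n₁ δ * conj (fibreSum f h m n₂ δ) =
      (∑ ν ∈ (polyRootsMod f (m * n₁)).filter
        (fun ν => ZMod.castHom (dvd_mul_right m n₁) (ZMod m) ν = ((δ : ℕ) : ZMod m)),
          ZMod.stdAddChar ((h : ZMod (m * n₁)) * ν)) *
      (∑ ν ∈ (polyRootsMod f (m * n₂)).filter
        (fun ν => ZMod.castHom (dvd_mul_right m n₂) (ZMod m) ν = ((δ : ℕ) : ZMod m)),
          ZMod.stdAddChar ((-h : ZMod (m * n₂)) * ν)) := by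
    intro δ hδ
    have hδm : δ < m := (mem_rootSet.1 hδ).1
    rw [fibreSum_eq_zmod f h hδm, conj_fibreSum_eq_zmod f h hδm]
  rw [Finset.sum_congr rfl hterm]
  rw [sum_rootSet_eq_sum_polyRootsMod f (fun x : ZMod m =>
      (∑ ν ∈ (polyRootsMod f (m * n₁)).filter
        (fun ν => ZMod.castHom (dvd_mul_right m n₁) (ZMod m) ν = x),
          ZMod.stdAddChar ((h : ZMod (m * n₁)) * ν)) *
      (∑ ν ∈ (polyRootsMod f (m * n₂)).filter
        (fun ν => ZMod.castHom (dvd_mul_right m n₂) (ZMod m) ν = x),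
          ZMod.stdAddChar ((-h : ZMod (m * n₂)) * ν)))]
  rw [sum_fibre_mul_fibre (polyRootsMod f m) (polyRootsMod f (m * n₁)) (polyRootsMod f (m * n₂))
      (fun ν => ZMod.castHom (dvd_mul_right m n₁) (ZMod m) ν)
      (fun ν => ZMod.castHom (dvd_mul_right m n₂) (ZMod m) ν)
      (fun ν hν => castHom_mem_polyRootsMod f (dvd_mul_right m n₁) hν)]
  rw [crt_fibre_sum_eq f m n₁ n₂ hm2 h12 h, polyRootWeylSum_eq_zmod]

end DFI1995

end Literature.NumberTheory.Sieve
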